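import Literature.ModelTheory.ExponentialFields.DefinableCompleteness
import Literature.ModelTheory.ExponentialFields.DefinabilityParams
import Literature.ModelTheory.ExponentialFields.OMinimalIntervals
import Mathlib.Topology.Order.IsLUB
import Mathlib.Topology.Order.DenselyOrdered
import HarnessLib

/-!
# Closed bounded intervals of a definably complete structure are definably compact

Topic `Literature/ModelTheory/ExponentialFields`.  The generalities on definably complete
structures (`FirstOrder.Language.IsDefinablyComplete`, `DefinableCompleteness.lean`) on which
the Macintyre–Wilkie / Jones–Servi route rests in every model of its recursive subtheory
(Fornasiero–Servi, *Definably complete Baire structures*, Fund. Math. 209 (2010), §1.2,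
"Generalities on definably complete structures can be found in [Servi], [DMS08] and
[Miller]"), in dimension one and for an arbitrary language on a dense linear order without
endpoints with `<` definable:

* `IsOMinimal.isDefinablyComplete` — o-minimal structures are definably complete
  (Fornasiero–Servi 2010, Examples 2.11; van den Dries 1998, Ch. 1, (3.3)(i));
* `IsDefinablyComplete.exists_isGLB_of_definable_lt` / `exists_isLeast_of_isClosed` — infima,
  and least elements of closed sets;
* **`IsDefinablyComplete.exists_forall_mem_of_antitone`** — Fornasiero–Servi 2010, Lemma 1.8
  (Miller) for `X = [a, b]`: a definable family `(Y y)_{y ∈ N}` of closed non-empty subsets of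
  `[a, b]`, decreasing along the definable index set `N`, has a common point;
* **`IsDefinablyComplete.exists_forall_le_of_continuousOn_Icc`** — the extreme value theorem
  for definable continuous functions on `[a, b]` (Fornasiero–Servi 2010, Lemma 1.16 (Miller):
  definable continuous images of definably compact sets are definably compact);
* **`IsDefinablyComplete.exists_mem_Icc_eq_of_continuousOn`** — the definable intermediate
  value theorem (C. Miller, *Expansions of dense linear orders with the intermediate value
  property*, J. Symbolic Logic 66 (2001)).

Conventions as in `OMinimalExtremeValue.lean`: functions `f : M → M` with definable graph
`{v | v 1 = f (v 0)}`, `<` definable (`hlt`), continuity in the order topology.  Everything is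
proved; nothing here is a named fact.

## References

* A. Fornasiero, T. Servi, *Definably complete Baire structures*, Fund. Math. 209 (2010),
  §1.2, Lemma 1.8, Lemma 1.16, Examples 2.11. [FornasieroServi2010]
* C. Miller, *Expansions of dense linear orders with the intermediate value property*,
  J. Symbolic Logic 66 (2001) 1783–1790. [Miller2001]
* L. van den Dries, *Tame topology and o-minimal structures* (1998), Ch. 1, (3.3). [Dries1998]
-/

open Set FirstOrder FirstOrder.Language
open _root_.Filter _root_.Topology

namespace Literature.ModelTheory.ExponentialFields

universe u v

variable {L : Language.{u, v}} {M : Type*} [L.Structure M] [LinearOrder M]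

/-! ### o-minimal structures are definably complete -/

/-- **o-minimal structures are definably complete** (on a dense order without endpoints): a
definable set is a finite union of points and intervals, which has a supremum when non-empty and
bounded above (van den Dries 1998, Ch. 1, (3.3)(i); Fornasiero–Servi 2010, Examples 2.11:
"Every o-minimal expansion of a field"). [cite: FornasieroServi2010, Examples 2.11] -/
theorem _root_.FirstOrder.Language.IsOMinimal.isDefinablyComplete [DenselyOrdered M]
    [NoMinOrder M] [NoMaxOrder M] (hO : L.IsOMinimal M) : L.IsDefinablyComplete M :=
  fun s hs hne hbdd => (hO s hs).exists_isLUB hne hbdd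

/-! ### Infima and least elements -/

/-- With `<` definable, the set of lower bounds of a definable set is definable. [folklore] -/
theorem definable₁_lowerBounds_of_definable_lt
    (hlt : (univ : Set M).Definable L {v : Fin 2 → M | v 0 < v 1}) {s : Set M}
    (hs : (univ : Set M).Definable₁ L s) : (univ : Set M).Definable₁ L (lowerBounds s) := by
  have h : (univ : Set M).Definable L {v : Fin 1 → M | ∀ y, y ∈ s → v 0 ≤ y} := by
    refine definable_setOf_forall_params (definable_setOf_imp_params ?_ ?_)
    · simpa [Set.Definable₁] using hs.preimage_comp (α := Fin 1) (β := Fin 1 ⊕ Unit)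
        (fun _ => Sum.inr ())
    · exact definable_setOf_le_params hlt (DefinableFun.proj _) (DefinableFun.proj _)
  simpa [Set.Definable₁, mem_lowerBounds] using h

/-- In a definably complete structure with `<` definable, a non-empty bounded-below definable
set has a greatest lower bound. [cite: FornasieroServi2010, Def. 1.5] -/
theorem _root_.FirstOrder.Language.IsDefinablyComplete.exists_isGLB_of_definable_lt
    (hDC : L.IsDefinablyComplete M)
    (hlt : (univ : Set M).Definable L {v : Fin 2 → M | v 0 < v 1}) {s : Set M}
    (hs : (univ : Set M).Definable₁ L s) (hne : s.Nonempty) (hbdd : BddBelow s) :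
    ∃ a, IsGLB s a := by
  obtain ⟨a, ha⟩ := hDC (lowerBounds s) (definable₁_lowerBounds_of_definable_lt hlt hs) hbdd
    (hne.mono (subset_upperBounds_lowerBounds s))
  exact ⟨a, isLUB_lowerBounds.1 ha⟩

/-- In a definably complete structure, a closed non-empty bounded-below definable set has a
least element (its infimum belongs to it). [folklore] -/
theorem _root_.FirstOrder.Language.IsDefinablyComplete.exists_isLeast_of_isClosed
    [TopologicalSpace M] [OrderTopology M] (hDC : L.IsDefinablyComplete M)
    (hlt : (univ : Set M).Definable L {v : Fin 2 → M | v 0 < v 1}) {s : Set M}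
    (hs : (univ : Set M).Definable₁ L s) (hcl : IsClosed s) (hne : s.Nonempty)
    (hbdd : BddBelow s) : ∃ m, IsLeast s m := by
  obtain ⟨a, ha⟩ := hDC.exists_isGLB_of_definable_lt hlt hs hne hbdd
  exact ⟨a, ha.mem_of_isClosed hne hcl, ha.1⟩

/-! ### Definable compactness of `[a, b]` (Fornasiero–Servi 2010, Lemma 1.8, after Miller) -/

section Compact

variable [TopologicalSpace M] [OrderTopology M]

omit [LinearOrder M] [TopologicalSpace M] [OrderTopology M] in
/-- The fibre `Y y` of a definable family is definable. [folklore] -/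
theorem definable₁_fibre {Y : M → Set M}
    (hY : (univ : Set M).Definable L {v : Fin 2 → M | v 1 ∈ Y (v 0)}) (y : M) :
    (univ : Set M).Definable₁ L (Y y) := by
  have h := definable_setOf_rel_params (r := fun y x => x ∈ Y y) hY
    (definableFun_const_params (Fin 1) (mem_univ y)) (DefinableFun.proj (i := 0) _)
  simpa [Set.Definable₁] using h

/-- **Definable compactness of `[a, b]`** (Fornasiero–Servi 2010, Lemma 1.8 (Miller), for
`X = [a, b]` in dimension one): in a definably complete structure with `<` definable, a definable
family `(Y y)_{y ∈ N}` of closed non-empty subsets of `[a, b]`, decreasing along a non-empty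
definable index set `N ⊆ M`, has a common point.  (Proof: the least elements `m_y` of the `Y y`
form a definable set bounded by `b`; its supremum `c` is, for each `y₀ ∈ N`, also the supremum
of `{m_y | y ≥ y₀} ⊆ Y y₀`, hence lies in the closed set `Y y₀`.) [cite: FornasieroServi2010, Lemma 1.8] -/
theorem _root_.FirstOrder.Language.IsDefinablyComplete.exists_forall_mem_of_antitone
    (hDC : L.IsDefinablyComplete M)
    (hlt : (univ : Set M).Definable L {v : Fin 2 → M | v 0 < v 1})
    {N : Set M} (hN : (univ : Set M).Definable₁ L N) (hNne : N.Nonempty)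
    {Y : M → Set M} (hY : (univ : Set M).Definable L {v : Fin 2 → M | v 1 ∈ Y (v 0)})
    (hanti : ∀ y ∈ N, ∀ y' ∈ N, y ≤ y' → Y y' ⊆ Y y)
    (hcl : ∀ y ∈ N, IsClosed (Y y)) (hne : ∀ y ∈ N, (Y y).Nonempty)
    {a b : M} (hsub : ∀ y ∈ N, Y y ⊆ Icc a b) :
    ∃ x, ∀ y ∈ N, x ∈ Y y := by
  -- least elements of the fibres
  have hleast : ∀ y ∈ N, ∃ m, IsLeast (Y y) m := fun y hy =>
    hDC.exists_isLeast_of_isClosed hlt (definable₁_fibre hY y) (hcl y hy) (hne y hy)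
      ⟨a, fun x hx => (hsub y hy hx).1⟩
  -- the definable set of least elements
  set G : Set M := {m | ∃ y, y ∈ N ∧ IsLeast (Y y) m} with hG
  have hGdef : (univ : Set M).Definable₁ L G := by
    have h : (univ : Set M).Definable L
        {v : Fin 1 → M | ∃ y, y ∈ N ∧ (v 0 ∈ Y y ∧ ∀ x, x ∈ Y y → v 0 ≤ x)} := by
      refine definable_setOf_exists_params (definable_setOf_and_params ?_
        (definable_setOf_and_params ?_ (definable_setOf_forall_params
          (definable_setOf_imp_params ?_ ?_))))
      · simpa [Set.Definable₁] using hN.preimage_comp (α := Fin 1) (β := Fin 1 ⊕ Unit)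
          (fun _ => Sum.inr ())
      · exact definable_setOf_rel_params (r := fun y x => x ∈ Y y) hY
          (DefinableFun.proj _) (DefinableFun.proj _)
      · exact definable_setOf_rel_params (r := fun y x => x ∈ Y y) hY
          (DefinableFun.proj _) (DefinableFun.proj _)
      · exact definable_setOf_le_params hlt (DefinableFun.proj _) (DefinableFun.proj _)
    simpa [Set.Definable₁, hG, IsLeast, mem_lowerBounds] using h
  obtain ⟨y₁, hy₁⟩ := hNne
  obtain ⟨m₁, hm₁⟩ := hleast y₁ hy₁
  have hGne : G.Nonempty := ⟨m₁, y₁, hy₁, hm₁⟩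
  have hGbdd : BddAbove G := ⟨b, fun m ⟨y, hy, hm⟩ => (hsub y hy hm.1).2⟩
  obtain ⟨c, hc⟩ := hDC G hGdef hGne hGbdd
  refine ⟨c, fun y₀ hy₀ => ?_⟩
  -- `c` is also the supremum of the least elements of the fibres beyond `y₀`
  set G' : Set M := {m | ∃ y, y ∈ N ∧ y₀ ≤ y ∧ IsLeast (Y y) m} with hG'
  obtain ⟨m₀, hm₀⟩ := hleast y₀ hy₀
  have hG'ne : G'.Nonempty := ⟨m₀, y₀, hy₀, le_rfl, hm₀⟩
  have hG'sub : G' ⊆ Y y₀ := fun m ⟨y, hy, hyy, hm⟩ => hanti y₀ hy₀ y hy hyy hm.1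
  have hc' : IsLUB G' c := by
    refine ⟨fun m ⟨y, hy, _, hm⟩ => hc.1 ⟨y, hy, hm⟩, fun u hu => hc.2 fun m ⟨y, hy, hm⟩ => ?_⟩
    rcases le_or_gt y₀ y with hyy | hyy
    · exact hu ⟨y, hy, hyy, hm⟩
    · exact (hm.2 (hanti y hy y₀ hy₀ hyy.le hm₀.1)).trans (hu ⟨y₀, hy₀, le_rfl, hm₀⟩)
  have hmem : c ∈ closure (Y y₀) := closure_mono hG'sub (hc'.mem_closure hG'ne)
  rwa [(hcl y₀ hy₀).closure_eq] at hmem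

end Compact

/-! ### The extreme value theorem -/

section Extreme

variable [TopologicalSpace M] [OrderTopology M] [DenselyOrdered M] [NoMinOrder M] [NoMaxOrder M]
  {f : M → M}

omit [TopologicalSpace M] [OrderTopology M] [DenselyOrdered M] [NoMinOrder M] [NoMaxOrder M] in
/-- The superlevel family `Y y = {x ∈ [a, b] | y ≤ f x}` of a function with definable graph is
definable. [folklore] -/
theorem definable_superlevel
    (hlt : (univ : Set M).Definable L {v : Fin 2 → M | v 0 < v 1})
    (hf : (univ : Set M).Definable L {v : Fin 2 → M | v 1 = f (v 0)}) (a b : M) :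
    (univ : Set M).Definable L
      {v : Fin 2 → M | v 1 ∈ {x | x ∈ Icc a b ∧ v 0 ≤ f x}} := by
  have h : (univ : Set M).Definable L
      {v : Fin 2 → M | (a ≤ v 1 ∧ v 1 ≤ b) ∧ v 0 ≤ f (v 1)} := by
    refine definable_setOf_and_params (definable_setOf_and_params ?_ ?_) ?_
    · exact definable_setOf_le_params hlt (definableFun_const_params _ (mem_univ a))
        (DefinableFun.proj _)
    · exact definable_setOf_le_params hlt (DefinableFun.proj _)
        (definableFun_const_params _ (mem_univ b))
    · exact definable_setOf_le_params hlt (DefinableFun.proj _)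
        (definableFun_apply_params hf (DefinableFun.proj _))
  simpa [mem_Icc] using h

omit [DenselyOrdered M] [NoMinOrder M] [NoMaxOrder M] in
/-- The superlevel sets `{x ∈ [a, b] | y ≤ f x}` of a function continuous on `[a, b]` are closed.
[folklore] -/
theorem isClosed_superlevel {a b : M} (hcont : ContinuousOn f (Icc a b)) (y : M) :
    IsClosed {x | x ∈ Icc a b ∧ y ≤ f x} :=
  hcont.preimage_isClosed_of_isClosed isClosed_Icc isClosed_Ici

omit [DenselyOrdered M] [NoMinOrder M] in
/-- **A definable continuous function is bounded above on `[a, b]`** (definable compactness of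
`[a, b]` applied to the superlevel family over all of `M`). [cite: FornasieroServi2010, Lemma 1.16] -/
theorem _root_.FirstOrder.Language.IsDefinablyComplete.bddAbove_image_Icc
    (hDC : L.IsDefinablyComplete M)
    (hlt : (univ : Set M).Definable L {v : Fin 2 → M | v 0 < v 1})
    (hf : (univ : Set M).Definable L {v : Fin 2 → M | v 1 = f (v 0)})
    {a b : M} (hcont : ContinuousOn f (Icc a b)) : BddAbove (f '' Icc a b) := by
  by_contra hun
  have hne : ∀ y ∈ (univ : Set M), {x | x ∈ Icc a b ∧ y ≤ f x}.Nonempty := by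
    intro y _
    by_contra h
    refine hun ⟨y, ?_⟩
    rintro _ ⟨x, hx, rfl⟩
    exact le_of_not_ge fun hyx => h ⟨x, hx, hyx⟩
  have hN : (univ : Set M).Definable₁ L (univ : Set M) := by simp [Set.Definable₁]
  obtain ⟨x, hx⟩ := hDC.exists_forall_mem_of_antitone hlt (N := univ) hN ⟨a, mem_univ a⟩
    (Y := fun y => {x | x ∈ Icc a b ∧ y ≤ f x}) (definable_superlevel hlt hf a b)
    (fun y _ y' _ hyy' x hx => ⟨hx.1, hyy'.trans hx.2⟩)
    (fun y _ => isClosed_superlevel hcont y) hne (fun y _ x hx => hx.1)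
  obtain ⟨y, hy⟩ := exists_gt (f x)
  exact (not_le.2 hy) (hx y (mem_univ y)).2

/-- **Extreme value theorem for definable continuous functions** (Fornasiero–Servi 2010,
Lemma 1.16 (Miller): a definable continuous image of a definably compact set is definably
compact; here: `f` attains its maximum on `[a, b]`).  In a definably complete structure on a
dense linear order without endpoints, with `<` definable, a function with definable graph which
is continuous on `[a, b]` (`a ≤ b`) attains a greatest value on `[a, b]`.  (The supremum `v` of
the values exists by definable completeness; the superlevel family `{x ∈ [a, b] | y ≤ f x}`,
`y < v`, has a common point by definable compactness, at which `f = v`.) [cite: FornasieroServi2010, Lemma 1.16] -/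
theorem _root_.FirstOrder.Language.IsDefinablyComplete.exists_forall_le_of_continuousOn_Icc
    (hDC : L.IsDefinablyComplete M)
    (hlt : (univ : Set M).Definable L {v : Fin 2 → M | v 0 < v 1})
    (hf : (univ : Set M).Definable L {v : Fin 2 → M | v 1 = f (v 0)})
    {a b : M} (hab : a ≤ b) (hcont : ContinuousOn f (Icc a b)) :
    ∃ c ∈ Icc a b, ∀ x ∈ Icc a b, f x ≤ f c := by
  -- the supremum of the values
  set V : Set M := f '' Icc a b with hV
  have hVdef : (univ : Set M).Definable₁ L V := by
    have h : (univ : Set M).Definable L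
        {v : Fin 1 → M | ∃ x, (a ≤ x ∧ x ≤ b) ∧ v 0 = f x} := by
      refine definable_setOf_exists_params (definable_setOf_and_params
        (definable_setOf_and_params ?_ ?_) ?_)
      · exact definable_setOf_le_params hlt (definableFun_const_params _ (mem_univ a))
          (DefinableFun.proj _)
      · exact definable_setOf_le_params hlt (DefinableFun.proj _)
          (definableFun_const_params _ (mem_univ b))
      · exact definable_setOf_eq_params (DefinableFun.proj _)
          (definableFun_apply_params hf (DefinableFun.proj _))
    have hVeq : V = {w | ∃ x, (a ≤ x ∧ x ≤ b) ∧ w = f x} := by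
      ext w
      simp only [hV, mem_image, mem_Icc, mem_setOf_eq]
      exact ⟨fun ⟨x, hx, hw⟩ => ⟨x, hx, hw.symm⟩, fun ⟨x, hx, hw⟩ => ⟨x, hx, hw.symm⟩⟩
    rw [Set.Definable₁, hVeq]
    simpa using h
  obtain ⟨v, hv⟩ := hDC V hVdef ⟨f a, a, left_mem_Icc.2 hab, rfl⟩
    (hDC.bddAbove_image_Icc hlt hf hcont)
  -- the superlevel family below `v` has a common point
  have hN : (univ : Set M).Definable₁ L (Iio v) := by
    have h := definable_setOf_lt_params hlt (DefinableFun.proj (i := (0 : Fin 1)) _)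
      (definableFun_const_params (Fin 1) (mem_univ v))
    simpa [Set.Definable₁] using h
  obtain ⟨y₁, hy₁⟩ := exists_lt v
  obtain ⟨x, hx⟩ := hDC.exists_forall_mem_of_antitone hlt hN ⟨y₁, hy₁⟩
    (Y := fun y => {x | x ∈ Icc a b ∧ y ≤ f x}) (definable_superlevel hlt hf a b)
    (fun y _ y' _ hyy' x hx => ⟨hx.1, hyy'.trans hx.2⟩)
    (fun y _ => isClosed_superlevel hcont y)
    (fun y hy => by
      obtain ⟨w, ⟨x, hx, rfl⟩, hyw⟩ := (lt_isLUB_iff hv).1 hy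
      exact ⟨x, hx, hyw.le⟩)
    (fun y _ x hx => hx.1)
  have hxI : x ∈ Icc a b := (hx y₁ hy₁).1
  refine ⟨x, hxI, fun x' hx' => (hv.1 ⟨x', hx', rfl⟩).trans ?_⟩
  exact le_of_forall_lt_imp_le_of_dense fun y hy => (hx y hy).2

end Extreme

/-! ### The intermediate value theorem -/

section IVT

variable [TopologicalSpace M] [OrderTopology M] [DenselyOrdered M] [NoMinOrder M] [NoMaxOrder M]
  {f : M → M}

/-- **Definable intermediate value theorem** (Miller 2001; Fornasiero–Servi 2010, §1.2): in a
definably complete structure on a dense linear order without endpoints, with `<` definable, a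
function with definable graph which is continuous on `[a, b]` takes on `[a, b]` every value
between `f a` and `f b`.  (The supremum `c` of `{x ∈ [a, b] | f x ≤ y}` has `f c = y`.)
[folklore] -/
theorem _root_.FirstOrder.Language.IsDefinablyComplete.exists_mem_Icc_eq_of_continuousOn
    (hDC : L.IsDefinablyComplete M)
    (hlt : (univ : Set M).Definable L {v : Fin 2 → M | v 0 < v 1})
    (hf : (univ : Set M).Definable L {v : Fin 2 → M | v 1 = f (v 0)})
    {a b : M} (hab : a ≤ b) (hcont : ContinuousOn f (Icc a b)) {y : M} (hay : f a ≤ y)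
    (hyb : y ≤ f b) : ∃ c ∈ Icc a b, f c = y := by
  set S : Set M := {x | x ∈ Icc a b ∧ f x ≤ y} with hS
  have hSdef : (univ : Set M).Definable₁ L S := by
    have h : (univ : Set M).Definable L
        {v : Fin 1 → M | (a ≤ v 0 ∧ v 0 ≤ b) ∧ f (v 0) ≤ y} := by
      refine definable_setOf_and_params (definable_setOf_and_params ?_ ?_) ?_
      · exact definable_setOf_le_params hlt (definableFun_const_params _ (mem_univ a))
          (DefinableFun.proj _)
      · exact definable_setOf_le_params hlt (DefinableFun.proj _)
          (definableFun_const_params _ (mem_univ b))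
      · exact definable_setOf_le_params hlt (definableFun_apply_params hf (DefinableFun.proj _))
          (definableFun_const_params _ (mem_univ y))
    simpa [Set.Definable₁, hS, mem_Icc] using h
  have hSa : a ∈ S := ⟨left_mem_Icc.2 hab, hay⟩
  obtain ⟨c, hc⟩ := hDC S hSdef ⟨a, hSa⟩ ⟨b, fun x hx => hx.1.2⟩
  have hScl : IsClosed S := hcont.preimage_isClosed_of_isClosed isClosed_Icc isClosed_Iic
  have hcS : c ∈ S := hc.mem_of_isClosed ⟨a, hSa⟩ hScl
  refine ⟨c, hcS.1, le_antisymm hcS.2 (le_of_not_gt fun hcy => ?_)⟩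
  -- if `f c < y` then `c < b` and points of `[a, b]` slightly to the right of `c` lie in `S`
  have hcb : c < b := lt_of_le_of_ne hcS.1.2 fun h => (hcy.trans_le hyb).ne (by rw [h])
  have hnhds : f ⁻¹' Iio y ∈ 𝓝[Icc a b] c := hcont c hcS.1 (Iio_mem_nhds hcy)
  obtain ⟨U, hU, hUsub⟩ := mem_nhdsWithin_iff_exists_mem_nhds_inter.1 hnhds
  obtain ⟨l, u, ⟨hl, hu⟩, hIoo⟩ := mem_nhds_iff_exists_Ioo_subset.1 hU
  obtain ⟨x, hcx, hxu⟩ := exists_between (lt_min hu hcb)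
  have hxI : x ∈ Icc a b := ⟨hcS.1.1.trans hcx.le, (hxu.trans_le (min_le_right _ _)).le⟩
  have hxU : x ∈ U := hIoo ⟨hl.trans hcx, hxu.trans_le (min_le_left _ _)⟩
  have hxS : x ∈ S := ⟨hxI, le_of_lt (hUsub ⟨hxU, hxI⟩)⟩
  exact (not_le.2 hcx) (hc.1 hxS)

end IVT

end Literature.ModelTheory.ExponentialFields
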